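import Summits.CriticalPhenomena.PercolationContinuityZ3.Theorems.FK.PartitionFunctionDecomposition
import Literature.Probability.LatticeModels.IsingThermodynamicsProofs
import HarnessLib

/-!
# FK-continuity cell, FO-10a (pressure layer): the VAN HOVE covering estimate for the random-cluster partition function —
# `|log Z⁰_Λ / |Λ| − log Z⁰_{C_n} / n^d| ≤ log q · ((2d+2) n^d |∂ᵉˣΛ| / |Λ| + 2d((n+2)^d − n^d) / n^d)` for every finite `Λ ⊆ ℤ^d`

Registered R96 (cell INBOX l.6711, 2026-08-24); registry row FO-10a-g339; label VHV-A (coordinator fk-4 g200).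
Cell `fk-continuity` (bschramm), row FO-10a; support file for the FK-continuity transplant
(`--supports stmt-CriticalPhenomena-4575`); builds on p205010 (kernel theorem, internal audit signed; external expert
review pending). Pure proofs; no definitions, no named facts, no sorries; general `d`.
UNCONDITIONAL finite-volume structure; it decides nothing about FH / TP_FK / the value of `p_c(q)`.

Grimmett 2006, Thm. (4.58) asserts that the pressure exists "independent of `ξ ∈ Ω` and of the way in which `Λ ↑ ℤ^d`".
The tree's `PressureThermodynamicLimit.lean` draws the limit along cubes and boxes; this file supplies the finite-volume
estimate behind the van Hove clause, by the covering argument of Friedli–Velenik 2017, proof of Thm. 3.6, eqs. (3.4)–(3.5),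
with the seam cost `log q` per boundary edge of Grimmett's Thm. (3.63) (`PartitionFunctionDecomposition.lean`): a finite
`Λ ⊆ ℤ^d` is the disjoint union of the tiles `nv + C_n` (`C_n = {0,…,n-1}^d`) it contains and a remainder `R`; every point
of `R` lies in a tile meeting the outer vertex boundary `∂ᵉˣΛ`, so `|R| ≤ n^d |∂ᵉˣΛ|`.

* `mem_map_shift_smul_halfOpenBox_iff` / `_self`, `card_biUnion_map_shift_smul_halfOpenBox` — the tiles `nv + C_n`
  partition `ℤ^d` (`x ∈ nv + C_n ↔ v = (x_i div n)_i`), `|⋃_{v∈A}(nv + C_n)| = |A| n^d`;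
* `exists_mem_outerBoundary_of_mem_map_shift_halfOpenBox` — a translated cube containing a point of `Λ` and a point
  outside `Λ` contains a point of `∂ᵉˣΛ` (one coordinate step at a time inside the cube);
* `card_sdiff_biUnion_tiles_le` — the remainder of the tiling of `Λ` has at most `|∂ᵉˣΛ| n^d` points (FV (3.5));
* `abs_log_rcPartitionFunction_biUnion_tiles_sub_le` — `|log Z⁰_{⋃_{v∈A}(nv+C_n)} − |A| log Z⁰_{C_n}| ≤ |A| 2d((n+2)^d − n^d) log q`;
* **`abs_log_rcPartitionFunction_div_card_sub_le`** — the estimate of the title (`q ≥ 1`, `0 ≤ p ≤ 1`, `n ≥ 1`,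
  `Λ` non-empty). The limit statements are drawn in `PressureVanHove.lean`.

Honest framing: finite-volume inequalities; no statement about `p_c(q)`; NOT a binder discharge, NOT `_r4`.

## References

* G. Grimmett, *The Random-Cluster Model*, Springer 2006 (`book:grimmett2006-random-cluster-model`): §4.5, Thm. (4.58) and
  its proof, (4.65)–(4.70); Thm. (3.63) [PDF pp. 88–92]. [Grimmett2006]
* S. Friedli, Y. Velenik, *Statistical Mechanics of Lattice Systems*, CUP 2017, §3.2.1 (van Hove convergence, eq. (3.4))
  and the proof of Thm. 3.6, eqs. (3.4)–(3.5). [FriedliVelenik2017]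
-/

noncomputable section

open Finset Filter Topology

namespace Summit.CriticalPhenomena.PercolationContinuityZ3.Theorems.FK

open Literature.Probability.Percolation Literature.Probability.LatticeModels

variable {d : ℕ}

/-! ### Tiles `nv + C_n` of `ℤ^d` -/

/-- Euclidean division: `a / P = w ↔ P w ≤ a < P w + P` for `P > 0`. [folklore] -/
theorem int_ediv_eq_iff_of_pos {P : ℤ} (hP : 0 < P) {a w : ℤ} : a / P = w ↔ P * w ≤ a ∧ a < P * w + P := by
  rw [le_antisymm_iff, ← Int.lt_add_one_iff, Int.ediv_lt_iff_lt_mul hP, Int.le_ediv_iff_mul_le hP]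
  have h1 : (w + 1) * P = P * w + P := by ring
  have h2 : w * P = P * w := mul_comm _ _
  rw [h1, h2]
  exact and_comm

/-- A site `x` lies in the tile `nv + C_n` iff `v` is the vector of integer parts `(x_i div n)_i`.
[cite: FriedliVelenik2017, Thm. 3.6 (proof), eq. (3.5)] -/
theorem mem_map_shift_smul_halfOpenBox_iff {n : ℕ} (hn : 0 < n) {v x : Site d} :
    x ∈ (halfOpenBox d n).map (Site.shift ((n : ℤ) • v)).toEmbedding ↔ (fun i => x i / (n : ℤ)) = v := by
  have hn' : (0 : ℤ) < n := by exact_mod_cast hn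
  rw [mem_map_shift_halfOpenBox, funext_iff]
  refine forall_congr' fun i => ?_
  rw [int_ediv_eq_iff_of_pos hn', Pi.smul_apply, smul_eq_mul]

/-- Every site lies in its own tile `n(x div n) + C_n`. [cite: FriedliVelenik2017, Thm. 3.6 (proof), eq. (3.5)] -/
theorem mem_map_shift_smul_halfOpenBox_self {n : ℕ} (hn : 0 < n) (x : Site d) :
    x ∈ (halfOpenBox d n).map (Site.shift ((n : ℤ) • fun i => x i / (n : ℤ))).toEmbedding :=
  (mem_map_shift_smul_halfOpenBox_iff hn).2 rfl

/-- The tiles indexed by a finite set `A` are pairwise disjoint and each has `n^d` points: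
`|⋃_{v ∈ A} (nv + C_n)| = |A| n^d`. [cite: FriedliVelenik2017, Thm. 3.6 (proof)] -/
theorem card_biUnion_map_shift_smul_halfOpenBox {n : ℕ} (hn : 0 < n) (A : Finset (Site d)) :
    #(A.biUnion fun v => (halfOpenBox d n).map (Site.shift ((n : ℤ) • v)).toEmbedding) = #A * n ^ d := by
  rw [Finset.card_biUnion (fun v _ w _ hvw => disjoint_map_shift_halfOpenBox hn hvw)]
  simp_rw [card_map_shift_halfOpenBox]
  rw [Finset.sum_const, smul_eq_mul]

/-- **Exit lemma**: a translated cube `a + C_n` containing a point of `Λ` and a point outside `Λ` contains a point of the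
outer vertex boundary `∂ᵉˣΛ` (move one coordinate at a time inside the cube; the first step leaving `Λ` lands in `∂ᵉˣΛ`).
[cite: FriedliVelenik2017, Thm. 3.6 (proof), eq. (3.5)] -/
theorem exists_mem_outerBoundary_of_mem_map_shift_halfOpenBox {a : Site d} {n : ℕ} {Λ : Finset (Site d)}
    {x y : Site d} (hx : x ∈ (halfOpenBox d n).map (Site.shift a).toEmbedding) (hxΛ : x ∈ Λ)
    (hy : y ∈ (halfOpenBox d n).map (Site.shift a).toEmbedding) (hyΛ : y ∉ Λ) :
    ∃ z ∈ (halfOpenBox d n).map (Site.shift a).toEmbedding, z ∈ outerBoundary (zdGraph d) Λ := by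
  suffices H : ∀ m : ℕ, ∀ x : Site d, x ∈ (halfOpenBox d n).map (Site.shift a).toEmbedding → x ∈ Λ →
      ∑ i, (y i - x i).natAbs = m →
      ∃ z ∈ (halfOpenBox d n).map (Site.shift a).toEmbedding, z ∈ outerBoundary (zdGraph d) Λ from
    H _ x hx hxΛ rfl
  intro m
  induction m using Nat.strong_induction_on with
  | _ m ih =>
    intro x hx hxΛ hm
    have hxy : x ≠ y := fun h => hyΛ (h ▸ hxΛ)
    obtain ⟨i, hi⟩ : ∃ i, x i ≠ y i := by
      by_contra h
      push Not at h
      exact hxy (funext h)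
    rw [mem_map_shift_halfOpenBox] at hx hy
    set v : ℤ := if x i < y i then x i + 1 else x i - 1 with hv
    set x' : Site d := Function.update x i v with hx'
    have hx'j : ∀ j, j ≠ i → x' j = x j := fun j hj => by simp [hx', hj]
    have hx'i : x' i = v := by simp [hx']
    have hx'T : x' ∈ (halfOpenBox d n).map (Site.shift a).toEmbedding := by
      rw [mem_map_shift_halfOpenBox]
      intro j
      rcases eq_or_ne j i with rfl | hj
      · rw [hx'i, hv]
        have h1 := hx j
        have h2 := hy j
        split_ifs <;> omega
      · rw [hx'j j hj]; exact hx j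
    have hadj : (zdGraph d).Adj x x' := by
      rw [zdGraph_adj_iff]
      refine ⟨i, ?_⟩
      by_cases hlt : x i < y i
      · left
        funext j
        rcases eq_or_ne j i with rfl | hj
        · simp [hx'i, hv, hlt]
        · simp [hx'j j hj, hj]
      · right
        funext j
        rcases eq_or_ne j i with rfl | hj
        · simp [hx'i, hv, hlt]
        · simp [hx'j j hj, hj]
    by_cases hx'Λ : x' ∈ Λ
    · have hlt : ∑ j, (y j - x' j).natAbs < m := by
        rw [← hm]
        apply Finset.sum_lt_sum
        · intro j _
          rcases eq_or_ne j i with rfl | hj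
          · rw [hx'i, hv]; split_ifs <;> omega
          · rw [hx'j j hj]
        · refine ⟨i, Finset.mem_univ _, ?_⟩
          rw [hx'i, hv]; split_ifs <;> omega
      exact ih _ hlt x' hx'T hx'Λ rfl
    · exact ⟨x', hx'T, mem_outerBoundary_iff.2 ⟨hx'Λ, x, hxΛ, hadj.symm⟩⟩

/-- **The remainder of the tiling is thin**: the points of `Λ` whose tile `n(x div n) + C_n` is not contained in `Λ` all
lie in tiles meeting `∂ᵉˣΛ`, so there are at most `|∂ᵉˣΛ| n^d` of them (Friedli–Velenik 2017, proof of Thm. 3.6,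
eq. (3.5): "`|Λ_n ∖ [Λ_n]| ≤ |∂ᵉˣΛ_n| |D_k|`"). [cite: FriedliVelenik2017, Thm. 3.6 (proof), eq. (3.5)] -/
theorem card_sdiff_biUnion_tiles_le {n : ℕ} (hn : 0 < n) (Λ : Finset (Site d)) :
    #(Λ \ ((Λ.image fun x : Site d => fun i => x i / (n : ℤ)).filter fun v =>
        (halfOpenBox d n).map (Site.shift ((n : ℤ) • v)).toEmbedding ⊆ Λ).biUnion
        fun v => (halfOpenBox d n).map (Site.shift ((n : ℤ) • v)).toEmbedding) ≤
      #(outerBoundary (zdGraph d) Λ) * n ^ d := by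
  classical
  set T : Site d → Finset (Site d) := fun v => (halfOpenBox d n).map (Site.shift ((n : ℤ) • v)).toEmbedding with hT
  set ι : Site d → Site d := fun x i => x i / (n : ℤ) with hι
  have hcover : Λ \ ((Λ.image ι).filter fun v => T v ⊆ Λ).biUnion T ⊆
      (outerBoundary (zdGraph d) Λ).biUnion fun z => T (ι z) := by
    intro x hx
    rw [Finset.mem_sdiff, Finset.mem_biUnion] at hx
    obtain ⟨hxΛ, hxin⟩ := hx
    have hxT : x ∈ T (ι x) := mem_map_shift_smul_halfOpenBox_self hn x
    have hnot : ¬ T (ι x) ⊆ Λ := fun hsub =>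
      hxin ⟨ι x, Finset.mem_filter.2 ⟨Finset.mem_image_of_mem ι hxΛ, hsub⟩, hxT⟩
    obtain ⟨y, hyT, hyΛ⟩ := Finset.not_subset.1 hnot
    obtain ⟨z, hzT, hz⟩ := exists_mem_outerBoundary_of_mem_map_shift_halfOpenBox hxT hxΛ hyT hyΛ
    rw [Finset.mem_biUnion]
    refine ⟨z, hz, ?_⟩
    have hιz : ι z = ι x := (mem_map_shift_smul_halfOpenBox_iff hn).1 hzT
    rw [hιz]
    exact hxT
  calc #(Λ \ ((Λ.image ι).filter fun v => T v ⊆ Λ).biUnion T)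
      ≤ #((outerBoundary (zdGraph d) Λ).biUnion fun z => T (ι z)) := Finset.card_le_card hcover
    _ ≤ ∑ z ∈ outerBoundary (zdGraph d) Λ, #(T (ι z)) := Finset.card_biUnion_le
    _ = #(outerBoundary (zdGraph d) Λ) * n ^ d := by
        simp_rw [hT, card_map_shift_halfOpenBox]
        rw [Finset.sum_const, smul_eq_mul]

/-! ### The finite-volume estimate -/

/-- **Tiles versus the cube**: `|log Z⁰_{⋃_{v∈A}(nv + C_n)} − |A| log Z⁰_{C_n}| ≤ |A| · 2d((n+2)^d − n^d) · log q` —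
seams between the `|A|` disjoint tiles (`PartitionFunctionDecomposition.lean`) and translation invariance.
[cite: Grimmett2006, proof of Thm. (4.58), (4.65)] -/
theorem abs_log_rcPartitionFunction_biUnion_tiles_sub_le {p q : ℝ} (hp : p ∈ Set.Icc (0 : ℝ) 1) (hq : 1 ≤ q)
    {n : ℕ} (hn : 0 < n) (A : Finset (Site d)) :
    |Real.log (rcPartitionFunction (finsetGraph (zdGraph d)
        (A.biUnion fun v => (halfOpenBox d n).map (Site.shift ((n : ℤ) • v)).toEmbedding)) p q ∅) -
        #A * Real.log (rcPartitionFunction (finsetGraph (zdGraph d) (halfOpenBox d n)) p q ∅)| ≤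
      #A * (2 * d * (((n : ℝ) + 2) ^ d - (n : ℝ) ^ d)) * Real.log q := by
  set T : Site d → Finset (Site d) := fun v =>
    (halfOpenBox d n).map (Site.shift ((n : ℤ) • v)).toEmbedding with hT
  have hdis : ∀ v ∈ A, ∀ w ∈ A, v ≠ w → Disjoint (T v) (T w) :=
    fun v _ w _ hvw => disjoint_map_shift_halfOpenBox hn hvw
  have hmain := abs_log_rcPartitionFunction_finsetGraph_biUnion_sub_sum_le (zdGraph d) hp hq A T hdis
  have hZ : ∀ v, Real.log (rcPartitionFunction (finsetGraph (zdGraph d) (T v)) p q ∅) =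
      Real.log (rcPartitionFunction (finsetGraph (zdGraph d) (halfOpenBox d n)) p q ∅) := fun v => by
    rw [hT, rcPartitionFunction_finsetGraph_map_shift]
  have hsum : ∑ v ∈ A, Real.log (rcPartitionFunction (finsetGraph (zdGraph d) (T v)) p q ∅) =
      #A * Real.log (rcPartitionFunction (finsetGraph (zdGraph d) (halfOpenBox d n)) p q ∅) := by
    rw [Finset.sum_congr rfl fun v _ => hZ v, Finset.sum_const, nsmul_eq_mul]
  have hle : n ^ d ≤ (n + 2) ^ d := Nat.pow_le_pow_left (by omega) d
  have hB : ∀ v, (#(edgeBoundary (zdGraph d) (T v)) : ℝ) ≤ 2 * d * (((n : ℝ) + 2) ^ d - (n : ℝ) ^ d) := by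
    intro v
    have := card_edgeBoundary_map_shift_halfOpenBox_le ((n : ℤ) • v) n (d := d)
    have hcast : ((2 * d * ((n + 2) ^ d - n ^ d) : ℕ) : ℝ) = 2 * d * (((n : ℝ) + 2) ^ d - (n : ℝ) ^ d) := by
      push_cast [Nat.cast_sub hle]
      ring
    rw [← hcast]
    exact_mod_cast this
  have hsumB : ∑ v ∈ A, (#(edgeBoundary (zdGraph d) (T v)) : ℝ) ≤
      #A * (2 * d * (((n : ℝ) + 2) ^ d - (n : ℝ) ^ d)) := by
    refine (Finset.sum_le_sum fun v _ => hB v).trans ?_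
    rw [Finset.sum_const, nsmul_eq_mul]
  rw [hsum] at hmain
  exact hmain.trans (mul_le_mul_of_nonneg_right hsumB (Real.log_nonneg hq))

/-- **The finite-volume van Hove estimate** (Friedli–Velenik 2017, proof of Thm. 3.6, eqs. (3.4)–(3.5), for the
random-cluster model with the seam cost `log q` of Grimmett 2006, Thm. (3.63)): for `q ≥ 1`, `0 ≤ p ≤ 1`, `n ≥ 1` and every
non-empty finite `Λ ⊆ ℤ^d`,
`|log Z⁰_Λ / |Λ| − log Z⁰_{C_n} / n^d| ≤ log q · ((2d+2) n^d |∂ᵉˣΛ| / |Λ| + 2d((n+2)^d − n^d) / n^d)`.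
[cite: Grimmett2006, proof of Thm. (4.58), (4.65)–(4.70)] -/
theorem abs_log_rcPartitionFunction_div_card_sub_le {p q : ℝ} (hp : p ∈ Set.Icc (0 : ℝ) 1) (hq : 1 ≤ q)
    {n : ℕ} (hn : 0 < n) {Λ : Finset (Site d)} (hΛ : Λ.Nonempty) :
    |Real.log (rcPartitionFunction (finsetGraph (zdGraph d) Λ) p q ∅) / (#Λ : ℝ) -
        Real.log (rcPartitionFunction (finsetGraph (zdGraph d) (halfOpenBox d n)) p q ∅) / (n : ℝ) ^ d| ≤
      Real.log q * ((2 * d + 2) * (n : ℝ) ^ d * #(outerBoundary (zdGraph d) Λ) / #Λ +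
        2 * d * (((n : ℝ) + 2) ^ d - (n : ℝ) ^ d) / (n : ℝ) ^ d) := by
  classical
  set T : Site d → Finset (Site d) := fun v => (halfOpenBox d n).map (Site.shift ((n : ℤ) • v)).toEmbedding with hT
  set ι : Site d → Site d := fun x i => x i / (n : ℤ) with hι
  set A : Finset (Site d) := (Λ.image ι).filter fun v => T v ⊆ Λ with hA
  set Λin : Finset (Site d) := A.biUnion T with hΛin
  set R : Finset (Site d) := Λ \ Λin with hR
  have hΛin_sub : Λin ⊆ Λ := by
    intro x hx
    rw [hΛin, Finset.mem_biUnion] at hx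
    obtain ⟨v, hv, hxv⟩ := hx
    exact (Finset.mem_filter.1 hv).2 hxv
  have hR_sub : R ⊆ Λ := Finset.sdiff_subset
  -- abbreviations for the real quantities
  set K : ℝ := Real.log q with hK
  set ZΛ : ℝ := Real.log (rcPartitionFunction (finsetGraph (zdGraph d) Λ) p q ∅)
  set ZR : ℝ := Real.log (rcPartitionFunction (finsetGraph (zdGraph d) R) p q ∅)
  set Zin : ℝ := Real.log (rcPartitionFunction (finsetGraph (zdGraph d) Λin) p q ∅)
  set c : ℝ := Real.log (rcPartitionFunction (finsetGraph (zdGraph d) (halfOpenBox d n)) p q ∅) with hc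
  set D : ℝ := 2 * d * (((n : ℝ) + 2) ^ d - (n : ℝ) ^ d) with hD
  have hK0 : 0 ≤ K := Real.log_nonneg hq
  have hN0 : (0 : ℝ) < (n : ℝ) ^ d := by positivity
  have hL0 : (0 : ℝ) < #Λ := by exact_mod_cast hΛ.card_pos
  -- (1) seams around the remainder: `|Z_Λ - (Z_R + Z_in)| ≤ 2d |R| K`
  have h1 : |ZΛ - (ZR + Zin)| ≤ 2 * d * #R * K := by
    have h := abs_log_rcPartitionFunction_finsetGraph_sub_add_le (zdGraph d) hp hq hR_sub
    rw [hR, Finset.sdiff_sdiff_eq_self hΛin_sub] at h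
    refine h.trans (mul_le_mul_of_nonneg_right ?_ hK0)
    rw [← hR]
    exact_mod_cast card_edgeBoundary_le_mul_card_of_degree_le (zdGraph d) card_incidenceFinset_zdGraph_le R
  -- (2) the tiles: `|Z_in - |A| c| ≤ |A| D K`
  have h2 : |Zin - #A * c| ≤ #A * D * K := abs_log_rcPartitionFunction_biUnion_tiles_sub_le hp hq hn A
  -- (3) a priori bounds
  have h3 : ZR ∈ Set.Icc 0 ((#R : ℝ) * K) := log_rcPartitionFunction_finsetGraph_mem_Icc (zdGraph d) hp hq R ∅
  have hcI : c ∈ Set.Icc 0 ((n : ℝ) ^ d * K) := by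
    have h := log_rcPartitionFunction_finsetGraph_mem_Icc (zdGraph d) hp hq (halfOpenBox d n) ∅
    rw [card_halfOpenBox] at h
    push_cast at h
    exact h
  -- (4) cardinalities
  have hcardin : (#Λin : ℝ) = #A * (n : ℝ) ^ d := by
    rw [hΛin, card_biUnion_map_shift_smul_halfOpenBox hn A]
    push_cast
    ring
  have hcardΛ : (#Λ : ℝ) = #R + #Λin := by
    rw [hR]
    exact_mod_cast (Finset.card_sdiff_add_card_eq_card hΛin_sub).symm
  have hRle : (#R : ℝ) ≤ #(outerBoundary (zdGraph d) Λ) * (n : ℝ) ^ d := by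
    have h := card_sdiff_biUnion_tiles_le hn Λ (d := d)
    rw [← hι, ← hT] at h
    change #(Λ \ ((Λ.image ι).filter fun v => T v ⊆ Λ).biUnion T) ≤ _ at h
    rw [← hA, ← hΛin, ← hR] at h
    exact_mod_cast h
  -- (5) assemble: `|Z_Λ - |A| c| ≤ (2d+1)|R| K + |A| D K`
  have h5 : |ZΛ - #A * c| ≤ (2 * d + 1) * #R * K + #A * D * K := by
    have e : ZΛ - #A * c = (ZΛ - (ZR + Zin)) + (Zin - #A * c) + ZR := by ring
    rw [e]
    refine (abs_add_le _ _).trans ((add_le_add (abs_add_le _ _) le_rfl).trans ?_)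
    rw [abs_of_nonneg h3.1]
    nlinarith [h1, h2, h3.2]
  -- (6) pass to densities
  have e : ZΛ / #Λ - c / (n : ℝ) ^ d = (ZΛ - #A * c) / #Λ - c * #R / (#Λ * (n : ℝ) ^ d) := by
    field_simp
    rw [hcardΛ, hcardin]
    ring
  rw [e]
  have hA_le : (#A : ℝ) * (n : ℝ) ^ d ≤ #Λ := by
    rw [hcardΛ, hcardin]; linarith [(Nat.cast_nonneg #R : (0 : ℝ) ≤ #R)]
  have t1 : |(ZΛ - #A * c) / #Λ| ≤ ((2 * d + 1) * #R * K + #A * D * K) / #Λ := by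
    rw [abs_div, abs_of_pos hL0]
    exact div_le_div_of_nonneg_right h5 hL0.le
  have t2 : |c * #R / (#Λ * (n : ℝ) ^ d)| ≤ #R * K / #Λ := by
    rw [abs_div, abs_of_pos (mul_pos hL0 hN0), abs_of_nonneg (mul_nonneg hcI.1 (Nat.cast_nonneg _)),
      div_le_div_iff₀ (mul_pos hL0 hN0) hL0]
    have : c * #R * #Λ ≤ (n : ℝ) ^ d * K * #R * #Λ := by
      have := hcI.2
      have hR0 : (0 : ℝ) ≤ #R := Nat.cast_nonneg _
      nlinarith [mul_nonneg hR0 hL0.le]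
    nlinarith [this]
  have hD0 : 0 ≤ D := by
    rw [hD]
    have : (n : ℝ) ^ d ≤ ((n : ℝ) + 2) ^ d := pow_le_pow_left₀ (by positivity) (by linarith) d
    have : (0 : ℝ) ≤ d := Nat.cast_nonneg d
    positivity
  calc |(ZΛ - #A * c) / #Λ - c * #R / (#Λ * (n : ℝ) ^ d)|
      ≤ |(ZΛ - #A * c) / #Λ| + |c * #R / (#Λ * (n : ℝ) ^ d)| := abs_sub _ _
    _ ≤ ((2 * d + 1) * #R * K + #A * D * K) / #Λ + #R * K / #Λ := add_le_add t1 t2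
    _ = K * ((2 * d + 2) * #R / #Λ + #A * D / #Λ) := by
        field_simp
        ring
    _ ≤ K * ((2 * d + 2) * (n : ℝ) ^ d * #(outerBoundary (zdGraph d) Λ) / #Λ + D / (n : ℝ) ^ d) := by
        refine mul_le_mul_of_nonneg_left (add_le_add ?_ ?_) hK0
        · refine div_le_div_of_nonneg_right ?_ hL0.le
          have h22 : (0 : ℝ) ≤ 2 * d + 2 := by positivity
          calc (2 * d + 2) * (#R : ℝ) ≤ (2 * d + 2) * (#(outerBoundary (zdGraph d) Λ) * (n : ℝ) ^ d) :=
                mul_le_mul_of_nonneg_left hRle h22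
            _ = (2 * d + 2) * (n : ℝ) ^ d * #(outerBoundary (zdGraph d) Λ) := by ring
        · rw [div_le_div_iff₀ hL0 hN0]
          calc (#A : ℝ) * D * (n : ℝ) ^ d = D * (#A * (n : ℝ) ^ d) := by ring
            _ ≤ D * #Λ := mul_le_mul_of_nonneg_left hA_le hD0

end Summit.CriticalPhenomena.PercolationContinuityZ3.Theorems.FK
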